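import Literature.Geometry.Riemannian.RicciFlowScalarCurvatureHolds
import Mathlib.Analysis.Calculus.Deriv.Prod
import Mathlib.LinearAlgebra.Matrix.NonsingularInverse
import HarnessLib

/-!
# The scalar curvature of a Ricci flow is smooth on space-time
(topic `Geometry/Riemannian`)

Regularity companion of `RicciFlow.lean` / `RicciFlowScalarCurvature.lean` /
`RicciFlowScalarMaximumPrinciple.lean`, towards the named fact
`Literature.Geometry.Riemannian.ricciFlow_scalarCurvature_lowerBound` (**Topping 2006,
Thm. 3.2.1**), whose printed proof inserts `u ≡ R` into the weak minimum principle (Cor. 3.1.2 of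
Thm. 3.1.1, proved in `RicciFlowScalarMaximumPrinciple.lean`), whose hypothesis is
`u ∈ C^∞(M × [0, T])`. Topping works under the standing convention of §1.2.3 ("`g(t)` is a smooth
family of smooth metrics – smooth all the way to `t = 0` and `t = T`"), under which all curvature
quantities are smooth on `M × [0, T]`; in the tree a Ricci flow (`IsRicciFlow g cov S`) is a
family `g` of `C^∞` metrics that is `C^∞` on `M × S` together with Levi-Civita witnesses `cov t`
(no regularity in `t` assumed) and the flow equation `∂g/∂t = -2 Ric(cov t)` within `S`. This
file PROVES that along such a flow on `[0, T]` the scalar curvature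
`R(x, t) = scalarCurvatureWith (g t) (cov t) x` is `C^∞` on `M × [0, T]`. Nothing is vendored.

## Contents (all proved)

* `contDiffOn_derivWithin_time`, `contMDiffOn_derivWithin_time` — the time derivative (within
  `[0, T]`, `T > 0`) of a function `C^∞` on `U × [0, T]`, `U` open in a vector space resp. in a
  boundaryless manifold, is `C^∞` on `U × [0, T]` (the smooth field `fderivWithin` evaluated at
  `(0, 1)`; read in a chart of `M`).
* `contMDiffWithinAt_matrix_det/adjugate/inv` — within-a-set forms of the entrywise matrix
  calculus of `CurvatureRegularity.lean`.
* `IsContMDiffFamilyOn.contMDiffOn_val_apply` — for a family of metrics `C^∞` on `M × S` and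
  `C^∞` vector fields `A, B` on an open `U`, `(x, t) ↦ g_t(x)(A x, B x)` is `C^∞` on `U × S`
  (Mathlib's `ContMDiffWithinAt.clm_bundle_apply₂` over the base map `M × ℝ → M`).
* **`IsRicciFlow.contMDiffOn_scalarCurvatureWith`** — for a Ricci flow on `[0, T]`,
  `(x, t) ↦ R(x, t)` is `C^∞` on `M × [0, T]`. Proof: in the smooth local frame `sᵢ` of `TM` near
  `x₀` (Mathlib's `Trivialization.localFrame`), the flow equation and uniqueness of one-sided
  derivatives on `[0, T]` (`T > 0`) give `Ric_t(x)(sᵢ, sⱼ) = -½ ∂_t [g_t(x)(sᵢ x, sⱼ x)]`, which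
  is smooth on `U × [0, T]` by the two lemmas above; the inverse Gram matrix of the frame is
  smooth; and `R = Σᵢⱼ (G⁻¹)ⱼᵢ Ric(sᵢ, sⱼ)` (`trace_eq_sum_gram_inv`, `CurvatureRegularity.lean`).
  For `T = 0` the statement is the spatial smoothness `IsLeviCivita.contMDiff_trace_ricci` at
  `t = 0`, and for `T < 0` it is void.

## Design notes

* The boundaryless model (`I.Boundaryless`, as everywhere in the layer) makes the targets of the
  extended charts open, so that `fderivWithin` on `(chart target) × [0, T]` is computed on a set
  of unique differentiability.
* No compactness, signature or `T > 0` hypothesis is needed in the final statement.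

## References

* P. Topping, *Lectures on the Ricci flow*, LMS Lecture Note Series 325, Cambridge Univ. Press
  2006, §1.2.3 (smoothness convention), §3.2, Thm. 3.2.1 (proof, p. 36). [Topping2006]
* B. O'Neill, *Semi-Riemannian geometry*, Academic Press 1983, Ch. 3, Def. 3.53
  (`S = C(Ric) ∈ 𝔉(M)`), pp. 60–61 (metric contraction in a frame). [ONeill1983]
-/

noncomputable section

open Bundle Set Filter Module Function Matrix
open scoped Manifold ContDiff Topology

namespace Literature.Geometry.Riemannian

open Lorentzian Lorentzian.PseudoRiemannianMetric

/-! ### The time derivative of a function smooth on `U × [0, T]` is smooth on `U × [0, T]` -/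

section TimeDerivative

variable {E : Type*} [NormedAddCommGroup E] [NormedSpace ℝ E] {H : Type*} [TopologicalSpace H]
  {I : ModelWithCorners ℝ E H} [I.Boundaryless] {M : Type*} [TopologicalSpace M] [ChartedSpace H M]
  [IsManifold I ∞ M]

/-- In a vector space: if `fh : E × ℝ → ℝ` is `C^∞` on `V × [0, T]` (`V` open, `T > 0`), then the
time derivative `(z, t) ↦ ∂_t fh (z, t)` (within `[0, T]`) is `C^∞` on `V × [0, T]`: it is the
smooth field `fderivWithin fh (V × [0, T])` evaluated at the constant vector `(0, 1)`. [folklore] -/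
theorem contDiffOn_derivWithin_time {V : Set E} (hV : IsOpen V) {T : ℝ} (hT : 0 < T)
    {fh : E × ℝ → ℝ} (hfh : ContDiffOn ℝ ∞ fh (V ×ˢ Icc 0 T)) :
    ContDiffOn ℝ ∞ (fun q : E × ℝ ↦ derivWithin (fun s ↦ fh (q.1, s)) (Icc 0 T) q.2)
      (V ×ˢ Icc 0 T) := by
  have hVI : UniqueDiffOn ℝ (V ×ˢ Icc 0 T) := hV.uniqueDiffOn.prod (uniqueDiffOn_Icc hT)
  have hG : ContDiffOn ℝ ∞ (fun q ↦ fderivWithin ℝ fh (V ×ˢ Icc 0 T) q ((0 : E), (1 : ℝ)))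
      (V ×ˢ Icc 0 T) :=
    (hfh.fderivWithin hVI (by simp)).clm_apply contDiffOn_const
  refine hG.congr fun q hq ↦ ?_
  -- identification of the two derivatives at `q ∈ V × [0, T]`
  have hd : HasFDerivWithinAt fh (fderivWithin ℝ fh (V ×ˢ Icc 0 T) q) (V ×ˢ Icc 0 T) q :=
    (hfh.differentiableOn (by simp) q hq).hasFDerivWithinAt
  have hc : HasDerivWithinAt (fun s : ℝ ↦ (q.1, s)) ((0 : E), (1 : ℝ)) (Icc 0 T) q.2 :=
    (hasDerivWithinAt_const _ _ _).prodMk (hasDerivWithinAt_id _ _)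
  have hmaps : MapsTo (fun s : ℝ ↦ (q.1, s)) (Icc 0 T) (V ×ˢ Icc 0 T) := fun s hs ↦ ⟨hq.1, hs⟩
  have hcomp := hd.comp_hasDerivWithinAt q.2 hc hmaps
  exact (hcomp.derivWithin (uniqueDiffOn_Icc hT q.2 hq.2))

/-- **The time derivative of a function smooth on `U × [0, T]` is smooth on `U × [0, T]`**
(`U ⊆ M` open, `T > 0`, derivative within `[0, T]`, i.e. one-sided at `t = 0, T`): read in a
chart of `M` this is `contDiffOn_derivWithin_time`. [folklore] -/
theorem contMDiffOn_derivWithin_time {U : Set M} (hU : IsOpen U) {T : ℝ} (hT : 0 < T)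
    {f : M × ℝ → ℝ} (hf : ContMDiffOn (I.prod 𝓘(ℝ, ℝ)) 𝓘(ℝ, ℝ) ∞ f (U ×ˢ Icc 0 T)) :
    ContMDiffOn (I.prod 𝓘(ℝ, ℝ)) 𝓘(ℝ, ℝ) ∞
      (fun p : M × ℝ ↦ derivWithin (fun s ↦ f (p.1, s)) (Icc 0 T) p.2) (U ×ˢ Icc 0 T) := by
  rintro ⟨x₀, t₀⟩ hp₀
  -- chart data at `x₀`
  set φ := extChartAt I x₀ with hφ
  set V : Set E := φ.target ∩ φ.symm ⁻¹' U with hVdef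
  have hV : IsOpen V :=
    (continuousOn_extChartAt_symm x₀).isOpen_inter_preimage (isOpen_extChartAt_target x₀) hU
  set fh : E × ℝ → ℝ := fun q ↦ f (φ.symm q.1, q.2) with hfhdef
  -- (1) `fh` is `C^∞` on `V × [0, T]`: the function read in the chart of `M × ℝ` at `(x₀, t₀)`
  have h1 : ContDiffOn ℝ ∞ fh (V ×ˢ Icc 0 T) := by
    have key := (contMDiffOn_iff.1 hf).2 (x₀, t₀) (f (x₀, t₀))
    have hset : (extChartAt (I.prod 𝓘(ℝ, ℝ)) (x₀, t₀)).target ∩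
        (extChartAt (I.prod 𝓘(ℝ, ℝ)) (x₀, t₀)).symm ⁻¹'
          (U ×ˢ Icc 0 T ∩ f ⁻¹' (extChartAt 𝓘(ℝ, ℝ) (f (x₀, t₀))).source) = V ×ˢ Icc 0 T := by
      ext ⟨z, s⟩
      simp only [extChartAt_prod, PartialEquiv.prod_target, PartialEquiv.prod_symm,
        PartialEquiv.prod_coe, extChartAt_model_space_eq_id, PartialEquiv.refl_target,
        PartialEquiv.refl_symm, PartialEquiv.refl_coe, PartialEquiv.refl_source, preimage_univ,
        inter_univ, mem_inter_iff, mem_prod, mem_univ, and_true, mem_preimage, hVdef, id]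
      tauto
    have hfun : (extChartAt 𝓘(ℝ, ℝ) (f (x₀, t₀))) ∘ f ∘
        (extChartAt (I.prod 𝓘(ℝ, ℝ)) (x₀, t₀)).symm = fh := by
      ext ⟨z, s⟩
      simp only [Function.comp_apply, hfhdef, hφ, extChartAt_prod, PartialEquiv.prod_symm,
        PartialEquiv.prod_coe, extChartAt_model_space_eq_id, PartialEquiv.refl_symm,
        PartialEquiv.refl_coe, id_eq]
    rw [hset, hfun] at key
    exact key
  -- (2) the time derivative of `fh` is `C^∞` on `V × [0, T]`
  have h2 := contDiffOn_derivWithin_time hV hT h1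
  -- (3) transport back: near `(x₀, t₀)` our function is `(derivative of fh) ∘ (φ × id)`
  have hΦ : ContMDiffOn (I.prod 𝓘(ℝ, ℝ)) 𝓘(ℝ, E × ℝ) ∞ (fun p : M × ℝ ↦ (φ p.1, p.2))
      ((chartAt H x₀).source ×ˢ (univ : Set ℝ)) :=
    ((contMDiffOn_extChartAt (x := x₀)).comp contMDiffOn_fst fun p hp ↦ hp.1).prodMk_space
      contMDiffOn_snd
  have h3 : ContMDiffOn (I.prod 𝓘(ℝ, ℝ)) 𝓘(ℝ, ℝ) ∞
      (fun p : M × ℝ ↦ derivWithin (fun s ↦ fh ((φ p.1, p.2).1, s)) (Icc 0 T) (φ p.1, p.2).2)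
      (((chartAt H x₀).source ∩ U) ×ˢ Icc 0 T) := by
    refine (contMDiffOn_iff_contDiffOn.2 h2).comp (hΦ.mono ?_) ?_
    · exact prod_mono inter_subset_left (subset_univ _)
    · rintro ⟨x, s⟩ ⟨⟨hx, hxU⟩, hs⟩
      refine ⟨⟨φ.map_source (by simpa [hφ, extChartAt_source] using hx), ?_⟩, hs⟩
      show φ.symm (φ x) ∈ U
      rwa [φ.left_inv (by simpa [hφ, extChartAt_source] using hx)]
  -- the two functions agree on `(chart source ∩ U) × [0, T]`
  have hagree : ∀ p ∈ ((chartAt H x₀).source ∩ U) ×ˢ Icc 0 T,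
      derivWithin (fun s ↦ f (p.1, s)) (Icc 0 T) p.2 =
        derivWithin (fun s ↦ fh ((φ p.1, p.2).1, s)) (Icc 0 T) (φ p.1, p.2).2 := by
    rintro ⟨x, t⟩ ⟨⟨hx, -⟩, -⟩
    have hxx : φ.symm (φ x) = x := φ.left_inv (by simpa [hφ, extChartAt_source] using hx)
    simp only [hfhdef, hxx]
  have h4 : ContMDiffOn (I.prod 𝓘(ℝ, ℝ)) 𝓘(ℝ, ℝ) ∞
      (fun p : M × ℝ ↦ derivWithin (fun s ↦ f (p.1, s)) (Icc 0 T) p.2)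
      (((chartAt H x₀).source ∩ U) ×ˢ Icc 0 T) := h3.congr hagree
  -- (4) conclude at `(x₀, t₀)`
  have hmem : (x₀, t₀) ∈ ((chartAt H x₀).source ∩ U) ×ˢ Icc 0 T :=
    ⟨⟨mem_chart_source H x₀, hp₀.1⟩, hp₀.2⟩
  refine (h4 _ hmem).mono_of_mem_nhdsWithin ?_
  have hnhds : ((chartAt H x₀).source ∩ U) ×ˢ (univ : Set ℝ) ∈ 𝓝 (x₀, t₀) :=
    prod_mem_nhds (((chartAt H x₀).open_source.inter hU).mem_nhds ⟨mem_chart_source H x₀, hp₀.1⟩)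
      univ_mem
  refine mem_nhdsWithin_iff_exists_mem_nhds_inter.2 ⟨_, hnhds, ?_⟩
  rintro ⟨x, s⟩ ⟨⟨hx, -⟩, ⟨-, hs⟩⟩
  exact ⟨hx, hs⟩

end TimeDerivative


/-! ### Matrices of `C^k` functions, within a set -/

section MatrixCalculus

variable {EM : Type*} [NormedAddCommGroup EM] [NormedSpace ℝ EM] {HM : Type*}
  [TopologicalSpace HM] {J : ModelWithCorners ℝ EM HM} {N : Type*} [TopologicalSpace N]
  [ChartedSpace HM N] {ι : Type*} [Fintype ι] [DecidableEq ι] {k : ℕ∞ω}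
  {A : N → Matrix ι ι ℝ} {s : Set N} {x₀ : N}

/-- The determinant of a matrix of functions `C^k` within `s` at `x₀` is `C^k` within `s` at `x₀`
(Leibniz expansion; the within-a-set form of `contMDiffAt_matrix_det`, `CurvatureRegularity.lean`).
[folklore] -/
theorem contMDiffWithinAt_matrix_det (hA : ∀ i j, CMDiffAt[s] k (fun x ↦ A x i j) x₀) :
    CMDiffAt[s] k (fun x ↦ (A x).det) x₀ := by
  simp only [Matrix.det_apply']
  refine contMDiffWithinAt_finsetSum fun σ _ ↦ ?_
  exact contMDiffWithinAt_const.mul (contMDiffWithinAt_finsetProd fun i _ ↦ hA _ _)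

/-- The entries of the adjugate of a matrix of functions `C^k` within `s` at `x₀` are `C^k`
within `s` at `x₀`. [folklore] -/
theorem contMDiffWithinAt_matrix_adjugate (hA : ∀ i j, CMDiffAt[s] k (fun x ↦ A x i j) x₀)
    (i j : ι) : CMDiffAt[s] k (fun x ↦ (A x).adjugate i j) x₀ := by
  simp only [Matrix.adjugate_apply]
  refine contMDiffWithinAt_matrix_det fun i' j' ↦ ?_
  by_cases h : i' = j
  · simp only [h, Matrix.updateRow_self]
    exact contMDiffWithinAt_const
  · simp only [Matrix.updateRow_ne h]
    exact hA i' j'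

/-- **The entries of the inverse of a matrix of functions `C^k` within `s` at `x₀` are `C^k`
within `s` at `x₀` where the determinant does not vanish** (`A⁻¹ = (det A)⁻¹ • adj A`).
[folklore] -/
theorem contMDiffWithinAt_matrix_inv (hA : ∀ i j, CMDiffAt[s] k (fun x ↦ A x i j) x₀)
    (h0 : (A x₀).det ≠ 0) (i j : ι) : CMDiffAt[s] k (fun x ↦ (A x)⁻¹ i j) x₀ := by
  simp only [Matrix.inv_def, Matrix.smul_apply, smul_eq_mul, Ring.inverse_eq_inv']
  exact ((contMDiffWithinAt_matrix_det hA).inv₀ h0).mul (contMDiffWithinAt_matrix_adjugate hA i j)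

end MatrixCalculus

/-! ### The scalar curvature of a Ricci flow is smooth on space-time -/

section Flow

variable {E : Type*} [NormedAddCommGroup E] [NormedSpace ℝ E] [FiniteDimensional ℝ E]
  [CompleteSpace E] {H : Type*} [TopologicalSpace H] {I : ModelWithCorners ℝ E H} [I.Boundaryless]
  {M : Type*} [TopologicalSpace M] [ChartedSpace H M] [IsManifold I ∞ M]
  {g : ℝ → PseudoRiemannianMetric I ∞ E (TangentSpace I : M → Type _)}
  {cov : ℝ → CovariantDerivative I E (TangentSpace I : M → Type _)}

omit [FiniteDimensional ℝ E] [CompleteSpace E] [I.Boundaryless] in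
/-- **Metric coefficients of a smooth family on smooth fields are smooth on space-time**: if the
family `g` is `C^∞` on `M × S` (`IsContMDiffFamilyOn`) and `A`, `B` are `C^∞` vector fields on an
open set `U`, then `(x, t) ↦ g_t(x)(A x, B x)` is `C^∞` on `U × S` (Mathlib's
`ContMDiffWithinAt.clm_bundle_apply₂` over the base map `M × ℝ → M`). [folklore] -/
theorem IsContMDiffFamilyOn.contMDiffOn_val_apply {S : Set ℝ} (hg : IsContMDiffFamilyOn ∞ g S)
    {U : Set M} {A B : Π x : M, TangentSpace I x}
    (hA : ContMDiffOn I (I.prod 𝓘(ℝ, E)) ∞ (fun x ↦ (⟨x, A x⟩ : TangentBundle I M)) U)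
    (hB : ContMDiffOn I (I.prod 𝓘(ℝ, E)) ∞ (fun x ↦ (⟨x, B x⟩ : TangentBundle I M)) U) :
    ContMDiffOn (I.prod 𝓘(ℝ, ℝ)) 𝓘(ℝ, ℝ) ∞
      (fun p : M × ℝ ↦ (g p.2).val p.1 (A p.1) (B p.1)) (U ×ˢ S) := by
  intro p hp
  have hψ : ContMDiffWithinAt (I.prod 𝓘(ℝ, ℝ)) (I.prod 𝓘(ℝ, E →L[ℝ] E →L[ℝ] ℝ)) ∞
      (fun p : M × ℝ ↦ TotalSpace.mk' (E →L[ℝ] E →L[ℝ] ℝ) (E := fun b : M ↦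
        TangentSpace I b →L[ℝ] TangentSpace I b →L[ℝ] ℝ) p.1 ((g p.2).val p.1)) (U ×ˢ S) p :=
    (hg p ⟨mem_univ _, hp.2⟩).mono (prod_mono (subset_univ _) Subset.rfl)
  have hmaps : MapsTo (Prod.fst : M × ℝ → M) (U ×ˢ S) U := fun q hq ↦ hq.1
  have hv : ContMDiffWithinAt (I.prod 𝓘(ℝ, ℝ)) (I.prod 𝓘(ℝ, E)) ∞
      (fun p : M × ℝ ↦ (⟨p.1, A p.1⟩ : TangentBundle I M)) (U ×ˢ S) p :=
    (hA p.1 hp.1).comp p contMDiffWithinAt_fst hmaps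
  have hw : ContMDiffWithinAt (I.prod 𝓘(ℝ, ℝ)) (I.prod 𝓘(ℝ, E)) ∞
      (fun p : M × ℝ ↦ (⟨p.1, B p.1⟩ : TangentBundle I M)) (U ×ˢ S) p :=
    (hB p.1 hp.1).comp p contMDiffWithinAt_fst hmaps
  have key : ContMDiffWithinAt (I.prod 𝓘(ℝ, ℝ)) (I.prod 𝓘(ℝ, ℝ)) ∞
      (fun p : M × ℝ ↦ TotalSpace.mk' ℝ (E := Bundle.Trivial M ℝ) p.1
        ((g p.2).val p.1 (A p.1) (B p.1))) (U ×ˢ S) p := by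
    apply ContMDiffWithinAt.clm_bundle_apply₂ (F₁ := E) (F₂ := E)
    · exact hψ
    · exact hv
    · exact hw
  rw [contMDiffWithinAt_totalSpace] at key
  exact key.2

/-- **The scalar curvature of a Ricci flow is `C^∞` on space-time** (the standing smoothness
convention of Topping 2006, §1.2.3 — "`g(t)` is a smooth family of smooth metrics – smooth all
the way to `t = 0` and `t = T`" — as used in the proof of Thm. 3.2.1, p. 36, where `u ≡ R` is
inserted into Thm. 3.1.1 whose hypothesis is `u ∈ C^∞(M × [0, T])`; the purely spatial statement
`R(·, t) ∈ C^∞(M)`, O'Neill 1983, Def. 3.53, is `IsLeviCivita.contMDiff_trace_ricci`). PROVED: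
for a Ricci flow `(g, cov)` on the time set `[0, T]` (`IsRicciFlow g cov (Icc 0 T)`) on a `C^∞`
manifold with boundaryless model, `(x, t) ↦ R(x, t) = scalarCurvatureWith (g t) (cov t) x` is
`C^∞` on `M × [0, T]` (as a map on the product manifold `M × ℝ`, the encoding of
`IsContMDiffFamilyOn`). *Proof.* For `T < 0` the set is empty and for `T = 0` this is spatial
smoothness at `t = 0`. For `T > 0`, near `x₀` take the smooth local frame `sᵢ` of `TM` induced by
the trivialization at `x₀` (Mathlib's `Trivialization.localFrame`); by the Ricci flow equation
and uniqueness of one-sided derivatives on `[0, T]`,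
`Ric_t(x)(sᵢ, sⱼ) = -½ ∂_t [g_t(x)(sᵢ x, sⱼ x)]`, the time derivative of a function smooth on
`U × [0, T]` (`IsContMDiffFamilyOn.contMDiffOn_val_apply`), hence smooth there
(`contMDiffOn_derivWithin_time`); the inverse Gram matrix of the frame is smooth
(`contMDiffWithinAt_matrix_inv`), and `R = Σᵢⱼ (G⁻¹)ⱼᵢ Ric(sᵢ, sⱼ)` (`trace_eq_sum_gram_inv`).
[cite: Topping2006, §1.2.3 and §3.2, Thm. 3.2.1 (proof, p. 36)] -/
theorem IsRicciFlow.contMDiffOn_scalarCurvatureWith {T : ℝ} (hflow : IsRicciFlow g cov (Icc 0 T)) :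
    ContMDiffOn (I.prod 𝓘(ℝ, ℝ)) 𝓘(ℝ, ℝ) ∞
      (fun p : M × ℝ ↦ (g p.2).scalarCurvatureWith (cov p.2) p.1) (univ ×ˢ Icc 0 T) := by
  rcases lt_trichotomy T 0 with hT | rfl | hT
  · -- `T < 0`: the time set is empty
    rintro ⟨x, t⟩ ⟨-, ht⟩
    exact absurd (ht.1.trans ht.2) (not_le.2 hT)
  · -- `T = 0`: spatial smoothness of `R(·, 0)`
    have h0 : (0 : ℝ) ∈ Icc (0 : ℝ) 0 := ⟨le_rfl, le_rfl⟩
    have hR : ContMDiff I 𝓘(ℝ, ℝ) ∞ (fun x ↦ (g 0).scalarCurvatureWith (cov 0) x) :=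
      (hflow.isLeviCivita 0 h0).contMDiff_trace_ricci
    have hG : ContMDiff (I.prod 𝓘(ℝ, ℝ)) 𝓘(ℝ, ℝ) ∞
        (fun p : M × ℝ ↦ (g 0).scalarCurvatureWith (cov 0) p.1) := hR.comp contMDiff_fst
    refine hG.contMDiffOn.congr ?_
    rintro ⟨x, t⟩ ⟨-, ht⟩
    have : t = 0 := le_antisymm ht.2 ht.1
    subst this
    rfl
  · -- `T > 0`: local frames
    rintro ⟨x₀, t₀⟩ hp₀
    classical
    set e := trivializationAt E (TangentSpace I : M → Type _) x₀ with he
    have hU : IsOpen e.baseSet := e.open_baseSet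
    have hx₀ : x₀ ∈ e.baseSet := mem_baseSet_trivializationAt E (TangentSpace I : M → Type _) x₀
    set bE := Module.finBasis ℝ E with hbE
    have hsf : ∀ i, ContMDiffOn I (I.prod 𝓘(ℝ, E)) ∞
        (fun x ↦ (⟨x, e.localFrame bE i x⟩ : TangentBundle I M)) e.baseSet := fun i ↦
      e.contMDiffOn_localFrame_baseSet ∞ bE i
    -- the metric coefficients in the frame and their time derivatives
    set Gf : Fin (finrank ℝ E) → Fin (finrank ℝ E) → M × ℝ → ℝ :=
      fun i j p ↦ (g p.2).val p.1 (e.localFrame bE i p.1) (e.localFrame bE j p.1) with hGf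
    have hGs : ∀ i j, ContMDiffOn (I.prod 𝓘(ℝ, ℝ)) 𝓘(ℝ, ℝ) ∞ (Gf i j) (e.baseSet ×ˢ Icc 0 T) :=
      fun i j ↦ hflow.smooth.contMDiffOn_val_apply (hsf i) (hsf j)
    have hDs : ∀ i j, ContMDiffOn (I.prod 𝓘(ℝ, ℝ)) 𝓘(ℝ, ℝ) ∞
        (fun p : M × ℝ ↦ derivWithin (fun s ↦ Gf i j (p.1, s)) (Icc 0 T) p.2)
        (e.baseSet ×ˢ Icc 0 T) := fun i j ↦ contMDiffOn_derivWithin_time hU hT (hGs i j)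
    -- the Ricci flow equation: `Ric_t(x)(sᵢ, sⱼ) = -½ ∂_t g_t(x)(sᵢ x, sⱼ x)`
    have hRic : ∀ i j, ∀ p ∈ e.baseSet ×ˢ Icc 0 T,
        (cov p.2).ricci p.1 (e.localFrame bE i p.1) (e.localFrame bE j p.1) =
          -(1 / 2) * derivWithin (fun s ↦ Gf i j (p.1, s)) (Icc 0 T) p.2 := by
      rintro i j ⟨x, t⟩ ⟨-, ht⟩
      have h := (hflow.hasDerivWithinAt t ht x (e.localFrame bE i x) (e.localFrame bE j x)).derivWithin
        (uniqueDiffOn_Icc hT t ht)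
      simp only [hGf]
      rw [h]
      ring
    -- the inverse Gram matrix of the frame is smooth
    have hdet : ∀ p ∈ e.baseSet ×ˢ Icc 0 T, (Matrix.of fun i j ↦ Gf i j p).det ≠ 0 := by
      rintro ⟨x, t⟩ ⟨hx, -⟩
      have := det_gram_ne_zero (g t) x (e.basisAt bE hx)
      simpa [hGf, e.localFrame_apply_of_mem_baseSet bE hx] using this
    have hInv : ∀ i j, ContMDiffOn (I.prod 𝓘(ℝ, ℝ)) 𝓘(ℝ, ℝ) ∞
        (fun p : M × ℝ ↦ (Matrix.of fun i j ↦ Gf i j p)⁻¹ i j) (e.baseSet ×ˢ Icc 0 T) :=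
      fun i j p hp ↦ contMDiffWithinAt_matrix_inv (fun i j ↦ hGs i j p hp) (hdet p hp) i j
    -- the formula for `R` on `e.baseSet × [0, T]`
    have hformula : ∀ p ∈ e.baseSet ×ˢ Icc 0 T,
        (g p.2).scalarCurvatureWith (cov p.2) p.1 =
          ∑ i, ∑ j, (Matrix.of fun i j ↦ Gf i j p)⁻¹ j i *
            (-(1 / 2) * derivWithin (fun s ↦ Gf i j (p.1, s)) (Icc 0 T) p.2) := by
      rintro ⟨x, t⟩ hp
      rw [scalarCurvatureWith, trace_eq_sum_gram_inv (g t) x (e.basisAt bE hp.1)]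
      refine Finset.sum_congr rfl fun i _ ↦ Finset.sum_congr rfl fun j _ ↦ ?_
      rw [← hRic i j (x, t) hp]
      simp only [hGf, e.localFrame_apply_of_mem_baseSet bE hp.1]
    have hrhs : ContMDiffOn (I.prod 𝓘(ℝ, ℝ)) 𝓘(ℝ, ℝ) ∞
        (fun p : M × ℝ ↦ ∑ i, ∑ j, (Matrix.of fun i j ↦ Gf i j p)⁻¹ j i *
          (-(1 / 2) * derivWithin (fun s ↦ Gf i j (p.1, s)) (Icc 0 T) p.2))
        (e.baseSet ×ˢ Icc 0 T) := by
      intro p hp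
      refine contMDiffWithinAt_finsetSum fun i _ ↦ contMDiffWithinAt_finsetSum fun j _ ↦ ?_
      exact (hInv j i p hp).mul (contMDiffWithinAt_const.mul (hDs i j p hp))
    have hloc : ContMDiffOn (I.prod 𝓘(ℝ, ℝ)) 𝓘(ℝ, ℝ) ∞
        (fun p : M × ℝ ↦ (g p.2).scalarCurvatureWith (cov p.2) p.1) (e.baseSet ×ˢ Icc 0 T) :=
      hrhs.congr hformula
    -- conclude at `(x₀, t₀)`
    refine (hloc _ ⟨hx₀, hp₀.2⟩).mono_of_mem_nhdsWithin ?_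
    refine mem_nhdsWithin_iff_exists_mem_nhds_inter.2
      ⟨e.baseSet ×ˢ (univ : Set ℝ), prod_mem_nhds (hU.mem_nhds hx₀) univ_mem, ?_⟩
    rintro ⟨x, s⟩ ⟨⟨hx, -⟩, ⟨-, hs⟩⟩
    exact ⟨hx, hs⟩

end Flow

end Literature.Geometry.Riemannian

end
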